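import Summits.HodgeConjecture.HodgeConjecture.Theses.BoundaryReadout
import Summits.HodgeConjecture.HodgeConjecture.Theorems.BallQuotientHodgeAbsolute.Negative.HodgeImpliesAbsoluteHodge
import Literature.AlgebraicGeometry.HodgeTheory.ComplexConjugationHolds
import Literature.AlgebraicGeometry.HodgeTheory.MiddleDimensionReductionOfHodgeModels
import Literature.AlgebraicGeometry.HodgeTheory.HodgeTypeExteriorProduct
import Literature.AlgebraicGeometry.Motives.VarietiesProjectiveSpaceProofs

/-!
# Crux `BoundarySupply` (stmt-HodgeConjecture-15912) — refuter lane: no degenerate witness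

Route `BoundaryReadout`, crux of rank 2
`Summit.HodgeConjecture.HodgeConjecture.Theses.BoundaryReadout.BoundarySupply`: every rational
`(p,p)`-class `c` on a smooth projective complex `X` is `e^*(ξ|_{X_t})` for a family `f : 𝒳 ⟶ C`
over a smooth projective curve whose fibre over some `o ∈ C(ℂ)` is COVERED by finitely many smooth
projective `Y_i` on which the global rational `(p,p)`-class `ξ` is ABSOLUTE HODGE.

Refuter findings (crux-attack, 2026-08-17), kernel-checked here:

* `nonempty_fiberOver_of_surjective`, `nonempty_index_of_cover` — the `∃`-block admits NO
  DEGENERATE WITNESS with an empty cover: `f` is surjective on points, so the scheme-theoretic fibre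
  `𝒳 ×_C Spec ℂ` over `o` has a point (Mathlib `Scheme.Pullback.exists_preimage_pullback`), hence the
  index type `ι` of any cover is nonempty and at least one conjunct
  `IsAbsoluteHodgeClass (m i) (Y i) p (ξ|_{Y_i})` must be PROVED by any proof of the crux.
* `absoluteWitness_of_boundarySupply` — the residue of the crux once the family is forgotten: every
  Hodge class `(X, c)` is `a^* ξ` for a rational `(p,p)`-class `ξ` on a smooth projective `𝒳` which
  also pulls back, along some `b : Y ⟶ 𝒳` with `Y` smooth projective, to an ABSOLUTE HODGE class.
* `charts_of_boundarySupply` — CHART LOWER BOUND: the crux implies that for every degree `2p` and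
  every `σ ∈ Aut ℂ` some smooth projective `Y` carries an absolute Hodge class in degree `2p`, hence a
  `ConjugationChart σ Y (2p)` (Jouanolou cover + analytifications of `Y`, `Y^σ` + a natural,
  rationally normalised complex de Rham family). No such chart is constructed in the tree today
  (module docstring of `HodgeTheory/AbsoluteHodgeClasses`, junk analysis (3)), so the crux is not
  closable by ANY witness before that construction exists — the same lower bound the refuter lane of
  `BallQuotientHodgeAbsolute` recorded for absoluteness statements
  (`Theorems/BallQuotientHodgeAbsolute/Negative/ChartConjugationUniqueness`).

* `isRationalClass_of_supplied`, `isOfHodgeType_of_supplied` — FORCED HYPOTHESES: in any witness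
  `c = e^*(ι_t^* ξ)` with `ξ` rational of type `(p,p)` on the smooth projective `𝒳` and `X_t` smooth
  projective, so both hypotheses on `c` are consequences of the conclusion (pull-back of `ℚ`-cocycles;
  Voisin I §7.3.2, PROVED tree theorems). Hence LOAD-BEARING ANALYSIS:
  `boundarySupply_false_without_isRationalClass` — the crux with `IsRationalClass c` dropped is FALSE
  outright (witness `X = ℙ⁰_ℂ`, `p = 0`, `c = i • ρ` for the non-zero rational top class `ρ`: of type
  `(0,0)` but, were it supplied, rational, whence `ρ = 0`); and
  `boundarySupply_withoutIsOfHodgeType_false_of` — the crux with `IsOfHodgeType` dropped is false as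
  soon as one smooth projective variety carries a rational class of degree `2p` not of type `(p,p)`
  (K3 / abelian surfaces, `p = 1`; witness not yet constructed on the tree's carriers, whence the
  hypothesis — same shape as `Theorems/AnchorExistence/Negative/LoadBearing`).

Nothing here asserts a Theses decl positively; the crux itself SURVIVES the cheap attacks (it is
HC-safe: implied by Charles–Schnell Conj. 11.2.17 via the constant family, planner's `Lines/birth`;
no CEILING theorem `HodgeConjecture → BoundarySupply` is landed — it needs the constant-family
construction and "cycle classes are absolute Hodge", both open in the tree).
-/

noncomputable section

-- `Summit.<Summit>.<Problem>`: for the single-conjunct summit the duplicate `HodgeConjecture.HodgeConjecture` is mandated.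
set_option linter.dupNamespace false

namespace Summit.HodgeConjecture.HodgeConjecture.Theorems.BoundarySupply.Negative

open CategoryTheory CategoryTheory.Limits AlgebraicGeometry
open Literature.AlgebraicGeometry.Motives Literature.AlgebraicGeometry.HodgeTheory
open Summit.HodgeConjecture.HodgeConjecture.Theses.BoundaryReadout

/-- The fibre `𝒳 ×_C Spec ℂ` of a point-surjective `ℂ`-morphism `f : 𝒳 ⟶ C` over a `ℂ`-point
`o ∈ C(ℂ)` is a nonempty scheme (points of fibre products, Hartshorne II Ex. 3.22 setting).
[folklore] -/
theorem nonempty_fiberOver_of_surjective {𝒳 C : SchemeOver ℂ} (f : 𝒳 ⟶ C)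
    (hf : Function.Surjective f.left.base) (o : AlgPoints C ℂ) :
    Nonempty ↥(fiberOver f o).left := by
  obtain ⟨x, hx⟩ := hf (o.left.base (IsLocalRing.closedPoint ℂ))
  obtain ⟨z, -, -⟩ := Scheme.Pullback.exists_preimage_pullback (f := f.left) (g := o.left) x
    (IsLocalRing.closedPoint ℂ) hx
  exact ⟨z⟩

/-- In any witness of the crux the index type of the cover of the fibre `X_o` is nonempty: the
empty family of pieces covers nothing, and the fibre has a point. [folklore] -/
theorem nonempty_index_of_cover {𝒳 C : SchemeOver ℂ} (f : 𝒳 ⟶ C)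
    (hf : Function.Surjective f.left.base) (o : AlgPoints C ℂ) {ι : Type}
    {Y : ι → SchemeOver ℂ} (g : ∀ i, Y i ⟶ fiberOver f o)
    (hcov : ∀ x : ↥(fiberOver f o).left, ∃ (i : ι) (y : ↥(Y i).left), (g i).left.base y = x) :
    Nonempty ι := by
  obtain ⟨x⟩ := nonempty_fiberOver_of_surjective f hf o
  obtain ⟨i, -, -⟩ := hcov x
  exact ⟨i⟩

/-- **No degenerate witness.** `BoundarySupply` forces, for every smooth projective `X` and every
rational `(p,p)`-class `c` on it, a smooth projective `𝒳` with a rational `(p,p)`-class `ξ` and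
`ℂ`-morphisms `a : X ⟶ 𝒳`, `b : Y ⟶ 𝒳` from `X` and from some smooth projective `Y` with
`a^* ξ = c` and `b^* ξ` ABSOLUTE HODGE on `Y` (take `a = e ≫ ι_t`, `b = g_i ≫ ι_o` for a piece `Y_i`
of the cover, which exists by `nonempty_index_of_cover`). [folklore] -/
theorem absoluteWitness_of_boundarySupply (hS : BoundarySupply) {n : ℕ} {X : SchemeOver ℂ}
    (hX : IsSmoothProjective n X) (p : ℕ) (c : complexBetti X (2 * p)) (hc : IsRationalClass c)
    (hpp : IsOfHodgeType n X (2 * p) p p c) :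
    ∃ (N m : ℕ) (𝒳 Y : SchemeOver ℂ) (a : X ⟶ 𝒳) (b : Y ⟶ 𝒳) (ξ : complexBetti 𝒳 (2 * p)),
      IsSmoothProjective N 𝒳 ∧ IsSmoothProjective m Y ∧ IsRationalClass ξ ∧
        IsOfHodgeType N 𝒳 (2 * p) p p ξ ∧ complexBetti.map a (2 * p) ξ = c ∧
          IsAbsoluteHodgeClass m Y p (complexBetti.map b (2 * p) ξ) := by
  obtain ⟨N, 𝒳, C, f, o, t, ι, _hι, m, Y, g, ξ, _n', e, h𝒳, _hC, hf, hY, hcov, hξr, hξh, habs, _ht,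
    hc'⟩ := hS hX p c hc hpp
  obtain ⟨i⟩ := nonempty_index_of_cover f hf o g hcov
  refine ⟨N, m i, 𝒳, Y i, e ≫ fiberι f t, g i ≫ fiberι f o, ξ, h𝒳, hY i, hξr, hξh, ?_, habs i⟩
  rw [complexBetti.map_comp]
  exact hc'

/-- **Chart lower bound.** `BoundarySupply` implies that for every `p` and every `σ ∈ Aut ℂ` some
smooth projective complex variety `Y` carries an absolute Hodge class in degree `2p`, hence admits a
conjugation chart `ConjugationChart σ Y (2p)` (apply the crux to `X = ℙ⁰_ℂ`, `c = 0`, rational and of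
type `(p,p)` by the PROVED Hodge-model existence, and read the existence conjunct of
`IsAbsoluteHodgeClass`). Any proof of the crux must therefore construct such charts for every `σ` —
none exists in the tree yet. [cite: Jouanolou1973, Lemme 1.5] -/
theorem charts_of_boundarySupply (hS : BoundarySupply) (p : ℕ) (σ : ℂ ≃+* ℂ) :
    ∃ (m : ℕ) (Y : SchemeOver ℂ) (d : complexBetti Y (2 * p)),
      IsSmoothProjective m Y ∧ IsAbsoluteHodgeClass m Y p d ∧
        Nonempty (ConjugationChart σ Y (2 * p)) := by
  have hP : IsSmoothProjective 0 (projectiveSpace 0 ℂ) := isSmoothProjective_projectiveSpace_holds ℂ 0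
  obtain ⟨_N, m, _𝒳, Y, _a, b, ξ, -, hY, -, -, -, habs⟩ :=
    absoluteWitness_of_boundarySupply hS hP p 0 IsRationalClass.zero
      (isOfHodgeType_zero_of_isSmoothProjective nonempty_hodgeModel_holds hP _ _ _)
  obtain ⟨_c', D, -⟩ := (habs.2.2 σ).1
  exact ⟨m, Y, _, hY, habs, ⟨D⟩⟩

/-! ### The hypotheses on the class are forced by the conclusion -/

/-- **A supplied class is rational**: if `c = e^*(ι_t^* ξ)` with `ξ` rational, then `c` is rational
(pull-back of a `ℚ`-valued cocycle, twice). [cite: HatcherAT2002, §3.1 p. 198] -/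
theorem isRationalClass_of_supplied {X 𝒳 C : SchemeOver ℂ} (f : 𝒳 ⟶ C) (t : AlgPoints C ℂ)
    (e : X ⟶ fiberOver f t) {k : ℕ} {ξ : complexBetti 𝒳 k} (hξ : IsRationalClass ξ)
    {c : complexBetti X k} (hc : complexBetti.map e k (complexBetti.map (fiberι f t) k ξ) = c) :
    IsRationalClass c :=
  hc ▸ (hξ.pullback _).pullback _

/-- **A supplied class is of type `(p,p)`**: if `c = e^*(ι_t^* ξ)` with `ξ` of type `(p,q)` on the
smooth projective `𝒳`, `X_t` and `X` smooth projective, then `c` is of type `(p,q)` (pull-backs along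
morphisms of smooth projective varieties preserve Hodge types, Voisin I §7.3.2 — PROVED tree theorem
`IsOfHodgeType.map_of_isSmoothProjective`). [cite: VoisinHodgeI2002, §7.3.2] -/
theorem isOfHodgeType_of_supplied {n N n' : ℕ} {X 𝒳 C : SchemeOver ℂ} (hX : IsSmoothProjective n X)
    (h𝒳 : IsSmoothProjective N 𝒳) (f : 𝒳 ⟶ C) (t : AlgPoints C ℂ)
    (ht : IsSmoothProjective n' (fiberOver f t)) (e : X ⟶ fiberOver f t) {k p q : ℕ}
    {ξ : complexBetti 𝒳 k} (hξ : IsOfHodgeType N 𝒳 k p q ξ) {c : complexBetti X k}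
    (hc : complexBetti.map e k (complexBetti.map (fiberι f t) k ξ) = c) :
    IsOfHodgeType n X k p q c :=
  hc ▸ (hξ.map_of_isSmoothProjective ht h𝒳 _).map_of_isSmoothProjective hX ht e

/-! ### Load-bearing hypotheses -/

/-- **The crux WITHOUT `IsRationalClass c` is false outright.** Witness: `X = ℙ⁰_ℂ`, `p = 0`, and
`c = i • ρ` where `ρ ∈ H⁰(ℙ⁰(ℂ); ℂ)` is a non-zero rational class (top degree `2·0`,
`exists_isRationalClass_ne_zero_of_degree_eq_two_mul`): `c` is of type `(0,0)` (every top-degree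
class is, `isOfHodgeType_of_degree_eq_two_mul`, in the Hodge model supplied by the PROVED fact
`nonempty_hodgeModel_holds`), so the mutilated crux would supply it, making `i • ρ` rational
(`isRationalClass_of_supplied`); but a class with `ρ` and `i • ρ` both rational is `0`
(`eq_zero_of_isRationalClass_of_I_smul`, complex conjugation fixes rational classes).
[cite: VoisinHodgeI2002, §6.1.3 Cor. 6.12] -/
theorem boundarySupply_false_without_isRationalClass :
    ¬ ∀ ⦃n : ℕ⦄ ⦃X : SchemeOver ℂ⦄, IsSmoothProjective n X →
      ∀ (p : ℕ) (c : complexBetti X (2 * p)), IsOfHodgeType n X (2 * p) p p c →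
        ∃ (N : ℕ) (𝒳 C : SchemeOver ℂ) (f : 𝒳 ⟶ C) (o t : AlgPoints C ℂ) (ι : Type) (_ : Finite ι)
          (m : ι → ℕ) (Y : ι → SchemeOver ℂ) (g : ∀ i, Y i ⟶ fiberOver f o)
          (ξ : complexBetti 𝒳 (2 * p)) (n' : ℕ) (e : X ⟶ fiberOver f t),
          IsSmoothProjective N 𝒳 ∧ IsSmoothProjective 1 C ∧ Function.Surjective f.left.base ∧
          (∀ i, IsSmoothProjective (m i) (Y i)) ∧
          (∀ x : ↥(fiberOver f o).left, ∃ (i : ι) (y : ↥(Y i).left), (g i).left.base y = x) ∧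
          IsRationalClass ξ ∧ IsOfHodgeType N 𝒳 (2 * p) p p ξ ∧
          (∀ i, IsAbsoluteHodgeClass (m i) (Y i) p
            (complexBetti.map (g i ≫ fiberι f o) (2 * p) ξ)) ∧
          IsSmoothProjective n' (fiberOver f t) ∧
          complexBetti.map e (2 * p) (complexBetti.map (fiberι f t) (2 * p) ξ) = c := by
  intro h
  have hP : IsSmoothProjective 0 (projectiveSpace 0 ℂ) := isSmoothProjective_projectiveSpace_holds ℂ 0
  obtain ⟨ρ, hρ, hρ0⟩ := exists_isRationalClass_ne_zero_of_degree_eq_two_mul hP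
  obtain ⟨A⟩ := nonempty_hodgeModel_holds hP
  have hI : IsOfHodgeType 0 (projectiveSpace 0 ℂ) (2 * 0) 0 0 (Complex.I • ρ) :=
    isOfHodgeType_of_degree_eq_two_mul A _
  obtain ⟨_N, 𝒳, C, f, _o, t, _ι, _hι, _m, _Y, _g, ξ, _n', e, -, -, -, -, -, hξr, -, -, -, hc'⟩ :=
    h hP 0 _ hI
  exact hρ0 (BallQuotientHodgeAbsolute.Negative.eq_zero_of_isRationalClass_of_I_smul hρ
    (isRationalClass_of_supplied f t e hξr hc'))

/-- **The crux WITHOUT `IsOfHodgeType` is false as soon as some smooth projective variety carries a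
rational class of degree `2p` NOT of type `(p,p)`** (a transcendental rational class in `H²` of a K3
or abelian surface, `p = 1`; not yet constructed on the tree's carriers, whence the hypothesis): the
supplied family would transport the type `(p,p)` of `ξ` to `c` (`isOfHodgeType_of_supplied`).
[cite: VoisinHodgeI2002, §7.1.1 and §7.3.2] -/
theorem boundarySupply_withoutIsOfHodgeType_false_of
    (hw : ∃ (n : ℕ) (X : SchemeOver ℂ) (p : ℕ) (c : complexBetti X (2 * p)),
      IsSmoothProjective n X ∧ IsRationalClass c ∧ ¬ IsOfHodgeType n X (2 * p) p p c) :
    ¬ ∀ ⦃n : ℕ⦄ ⦃X : SchemeOver ℂ⦄, IsSmoothProjective n X →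
      ∀ (p : ℕ) (c : complexBetti X (2 * p)), IsRationalClass c →
        ∃ (N : ℕ) (𝒳 C : SchemeOver ℂ) (f : 𝒳 ⟶ C) (o t : AlgPoints C ℂ) (ι : Type) (_ : Finite ι)
          (m : ι → ℕ) (Y : ι → SchemeOver ℂ) (g : ∀ i, Y i ⟶ fiberOver f o)
          (ξ : complexBetti 𝒳 (2 * p)) (n' : ℕ) (e : X ⟶ fiberOver f t),
          IsSmoothProjective N 𝒳 ∧ IsSmoothProjective 1 C ∧ Function.Surjective f.left.base ∧
          (∀ i, IsSmoothProjective (m i) (Y i)) ∧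
          (∀ x : ↥(fiberOver f o).left, ∃ (i : ι) (y : ↥(Y i).left), (g i).left.base y = x) ∧
          IsRationalClass ξ ∧ IsOfHodgeType N 𝒳 (2 * p) p p ξ ∧
          (∀ i, IsAbsoluteHodgeClass (m i) (Y i) p
            (complexBetti.map (g i ≫ fiberι f o) (2 * p) ξ)) ∧
          IsSmoothProjective n' (fiberOver f t) ∧
          complexBetti.map e (2 * p) (complexBetti.map (fiberι f t) (2 * p) ξ) = c := by
  intro h
  obtain ⟨n, X, p, c, hX, hc, hpp⟩ := hw
  obtain ⟨_N, 𝒳, C, f, _o, t, _ι, _hι, _m, _Y, _g, ξ, _n', e, h𝒳, -, -, -, -, -, hξh, -, ht, hc'⟩ :=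
    h hX p c hc
  exact hpp (isOfHodgeType_of_supplied hX h𝒳 f t ht e hξh hc')

end Summit.HodgeConjecture.HodgeConjecture.Theorems.BoundarySupply.Negative

end
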